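import Mathlib
import HarnessLib

/-!
# Formal horizontal sections vanishing at the centre vanish
# (helper for `AnchorsAtGenericHodgeLocusPoints`, stmt-HodgeConjecture-13944)

Route `PadicSemiregularLift` of `HodgeConjecture`, informal support item P2b
`AnchorsAtGenericHodgeLocusPoints`, abelian half (B1), propagation step: "`φ` is horizontal on the
Gauss–Manin `F`-crystal of the disc, and a horizontal section vanishing at one `W`-point of the disc
vanishes (Ogus 1982 (4.7), (4.12))". Its formal core in one variable, over real carriers
(`PowerSeries`, Mathlib's formal derivative `d⁄dX`): for a ring `R` without additive torsion
(characteristic-zero situation, `IsAddTorsionFree R`) and a formal linear system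
`d⁄dX sᵢ = Σⱼ Aᵢⱼ sⱼ` with coefficients `Aᵢⱼ ∈ R⟦X⟧` — the horizontality equation of a section
`s = (sᵢ)` of the trivial bundle with connection `∇ = d - A dX` —

* `coeff_eq_zero_of_derivative_eq_sum_mul` — if every `sᵢ` has constant term `0` then every
  coefficient of every `sᵢ` vanishes (strong induction: `(m+1) · coeff_{m+1} sᵢ` is a combination of
  lower coefficients);
* `eq_zero_of_derivative_eq_sum_mul` — hence `s = 0`: a horizontal section vanishing at the centre
  of the formal disc vanishes identically;
* `eq_of_derivative_eq_sum_mul` — two horizontal sections with the same value at the centre coincide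
  (parallel transport on the formal disc is unique).

References: A. Ogus, *Hodge cycles and crystalline cohomology*, LNM 900 (1982), (4.7), proof of
(4.12) [Ogus1982]; N. Katz, *Nilpotent connections and the monodromy theorem*, Publ. IHÉS 39 (1970),
§8 (formal horizontal sections / Taylor expansion in characteristic zero) [folklore].
-/

-- the summit-side namespace `Summit.HodgeConjecture.HodgeConjecture.…` (summit = sub-problem, D-0017)
-- repeats a component by design; the linter would flag every declaration.
set_option linter.dupNamespace false

namespace Summit.HodgeConjecture.HodgeConjecture.Theorems.AnchorsAtGenericHodgeLocusPoints

open PowerSeries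

variable {R : Type*} [CommRing R] [IsAddTorsionFree R] {n : ℕ}

/-- **Taylor coefficients of a horizontal section vanishing at the centre vanish.** If
`d⁄dX sᵢ = Σⱼ Aᵢⱼ sⱼ` for all `i` and all constant terms `sᵢ(0)` are `0`, then `coeff m sᵢ = 0` for
all `m, i` (`R` without additive torsion). [cite: Ogus1982, (4.7)] -/
theorem coeff_eq_zero_of_derivative_eq_sum_mul (A : Fin n → Fin n → R⟦X⟧) (s : Fin n → R⟦X⟧)
    (hs : ∀ i, d⁄dX R (s i) = ∑ j, A i j * s j) (h0 : ∀ i, constantCoeff (s i) = 0) :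
    ∀ (m : ℕ) (i : Fin n), coeff m (s i) = 0 := by
  intro m
  induction m using Nat.strong_induction_on with
  | _ m ih =>
    intro i
    cases m with
    | zero =>
      rw [coeff_zero_eq_constantCoeff]
      exact h0 i
    | succ m =>
      have h := congrArg (coeff m) (hs i)
      have hR : coeff m (∑ j, A i j * s j) = 0 := by
        rw [map_sum]
        refine Finset.sum_eq_zero fun j _ => ?_
        rw [coeff_mul]
        refine Finset.sum_eq_zero fun x hx => ?_
        rw [ih x.2 (Nat.lt_succ_of_le (Finset.HasAntidiagonal.antidiagonal.snd_le hx)) j, mul_zero]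
      rw [hR, coeff_derivative, ← Nat.cast_succ, mul_comm, ← nsmul_eq_mul] at h
      have h' : (m + 1) • coeff (m + 1) (s i) = (m + 1) • (0 : R) := by rwa [smul_zero]
      exact (smul_right_inj m.succ_ne_zero).1 h'

/-- **A horizontal section vanishing at the centre of the formal disc vanishes**: if
`d⁄dX sᵢ = Σⱼ Aᵢⱼ sⱼ` for all `i` and `sᵢ(0) = 0` for all `i`, then `s = 0`. [cite: Ogus1982, (4.7)] -/
theorem eq_zero_of_derivative_eq_sum_mul (A : Fin n → Fin n → R⟦X⟧) (s : Fin n → R⟦X⟧)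
    (hs : ∀ i, d⁄dX R (s i) = ∑ j, A i j * s j) (h0 : ∀ i, constantCoeff (s i) = 0) : s = 0 := by
  funext i
  ext m
  rw [coeff_eq_zero_of_derivative_eq_sum_mul A s hs h0 m i, Pi.zero_apply, map_zero]

/-- **Uniqueness of parallel transport on the formal disc**: two solutions of the linear system
`d⁄dX sᵢ = Σⱼ Aᵢⱼ sⱼ` with the same values at the centre coincide. [cite: Ogus1982, (4.7)] -/
theorem eq_of_derivative_eq_sum_mul (A : Fin n → Fin n → R⟦X⟧) (s t : Fin n → R⟦X⟧)
    (hs : ∀ i, d⁄dX R (s i) = ∑ j, A i j * s j) (ht : ∀ i, d⁄dX R (t i) = ∑ j, A i j * t j)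
    (h0 : ∀ i, constantCoeff (s i) = constantCoeff (t i)) : s = t := by
  have h : s - t = 0 := by
    refine eq_zero_of_derivative_eq_sum_mul A (s - t) (fun i => ?_) (fun i => ?_)
    · simp only [Pi.sub_apply, map_sub, hs i, ht i, ← Finset.sum_sub_distrib, mul_sub]
    · simp only [Pi.sub_apply, map_sub, h0 i, sub_self]
  exact sub_eq_zero.1 h

end Summit.HodgeConjecture.HodgeConjecture.Theorems.AnchorsAtGenericHodgeLocusPoints
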